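import Summits.QuantumFields.YangMills.Theorems.LuscherReductionTwistedTraceScalingToronProduct
import Mathlib.Data.Fin.Tuple.Basic
import HarnessLib

/-!
# TORON MINIMALITY of the lattice zero-point energy: the one-loop (harmonic transfer-kernel) energy of a flat `SU(2)` background on `(ℤ/L)³`
# is minimal at the torons, and the gain is at least the one-dimensional massless gain of any single twisted direction
# (VALLEY term of both COARSE lanes of S-BASE, crux `TwistedTraceScaling` stmt-QuantumFields-20203; design note
# `pub/ym-fleet/ym-luscher-20007-p1/COARSE-DESIGN.md` §12)

Near a flat connection with adjoint holonomy phases `α = (α₁, α₂, α₃)` the charged normal modes of the (twisted) stiff Hessian have the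
eigenvalues `a = Σ_k (2 − 2cos(p_k + α_k))`, `p ∈ (2π/L)ℤ_L³`, and the harmonic transfer kernel with kinetic `b‖x−y‖²` and magnetic `t⟪x,Hx⟫`
(`TwoLattice.Stiff.stiff_groundState`) has one factor `√(π/b)·e^{−½arcosh(1 + κa)}` per mode, `κ = t/b`.  This file defines the charged-mode sum
`toronZPE L κ m α = Σ_j ½arcosh(1 + m + κ·Σ_k(2 − 2cos(α_k + 2πj_k/L)))` (mass `m ≥ 0`; the physical one is `m = 0`) and proves:

* ★★ `toronZPE_zero_le` (THEOREM A): `toronZPE L κ 0 0 ≤ toronZPE L κ 0 α` — the TORONS (`α ∈ (2π/L)ℤ³`, where the sum takes its `α = 0` value by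
  periodicity, `toronZPE_add_period`) MINIMISE the zero-point energy;  `toronZPE_update_zero_le`: zeroing any one twist never raises it;
* ★★ `toronZPE_zero_add_gain1_le` (THEOREM B, reduction): `toronZPE L κ 0 0 + gain1 L κ (α k) ≤ toronZPE L κ 0 α` for every direction `k`, with
  `gain1 L κ a = Σ_{i<L} [½arcosh(1 + κ(2 − 2cos(a + 2πi/L))) − ½arcosh(1 + κ(2 − 2cos(2πi/L)))]` the ONE-DIMENSIONAL MASSLESS GAIN (the transverse
  zero-point gain of the constant charged modes plus their 1D tower) — bounded below linearly in `dist(a, (2π/L)ℤ)` in `…ToronGain`.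
Method (no special functions, no Fourier series): the twisted massive 1D determinant is minimal at zero twist (`…ToronProduct`), products over the
other directions and over a temporal direction of every length `T`, and the transfer trick `sum_le_sum_of_prod_cosh_le`; the mass is removed by
continuity.

HONEST FRAMING: an inequality about finite sums of `arcosh`; the identification with the stiff spectrum at a flat background and the valley row
bound are NOT done here; femto rung R2b1 (brick for a stub of a child of a CONDITIONAL route); not a gap, not Clay.
-/

set_option autoImplicit false

noncomputable section

open Finset Filter Topology
open scoped BigOperators

namespace Summit.QuantumFields.YangMills.Theorems.FemtoTransferGap.TwoLattice.Toron

/-! ## §1 Definitions -/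

/-- One-direction twisted lattice Laplacian symbol `2 − 2cos(a + 2πi/L)` (momentum `2πi/L`, twist `a`). [folklore] -/
def lap1 (L : ℕ) (a : ℝ) (i : Fin L) : ℝ := 2 - 2 * Real.cos (a + 2 * Real.pi * (i : ℕ) / L)

/-- The twisted Laplacian eigenvalue in three directions, `Σ_k (2 − 2cos(α_k + 2πj_k/L))`. [folklore] -/
def lap3 (L : ℕ) (α : Fin 3 → ℝ) (j : Fin 3 → Fin L) : ℝ := ∑ k, lap1 L (α k) (j k)

/-- The two transverse directions' contribution `Σ_{k<2} (2 − 2cos(α'_k + 2πj'_k/L))`. [folklore] -/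
def lap2 (L : ℕ) (α' : Fin 2 → ℝ) (j' : Fin 2 → Fin L) : ℝ := ∑ k, lap1 L (α' k) (j' k)

/-- Zero-point energy of one harmonic transfer mode with (scaled) Hessian eigenvalue `y`: `½·arcosh(1 + y)` (`= −log` of the mode's eigenvalue factor
`(1 + y + √(y² + 2y))^{−1/2}`). [cite: Wipf2021, §8.5.1 (8.56)–(8.58)] -/
def modeZPE (y : ℝ) : ℝ := Real.arcosh (1 + y) / 2

/-- **The charged-mode zero-point energy at a flat background** with twists `α`, scale `κ` and mass `m`:
`Σ_{j : Fin 3 → Fin L} ½arcosh(1 + m + κ·lap3 α j)`. [cite: Luscher1983, §3] -/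
def toronZPE (L : ℕ) (κ m : ℝ) (α : Fin 3 → ℝ) : ℝ := ∑ j : Fin 3 → Fin L, modeZPE (m + κ * lap3 L α j)

/-- **The one-dimensional massless gain** of a twist `a`: `Σ_{i<L} [½arcosh(1 + κ(2 − 2cos(a + 2πi/L))) − ½arcosh(1 + κ(2 − 2cos(2πi/L)))]`.
[cite: Luscher1983, §3] -/
def gain1 (L : ℕ) (κ a : ℝ) : ℝ := ∑ i : Fin L, (modeZPE (κ * lap1 L a i) - modeZPE (κ * lap1 L 0 i))

/-- Generalised sums: transverse data `rest j'`, direction-0 twist `τ j'` allowed to depend on the transverse momentum `j'`. [folklore] -/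
def genSum (L : ℕ) (κ m : ℝ) (rest τ : (Fin 2 → Fin L) → ℝ) : ℝ :=
  ∑ j' : Fin 2 → Fin L, ∑ i : Fin L, modeZPE (m + κ * (rest j' + lap1 L (τ j') i))

/-- Generalised determinants `Π_{j'} Π_i (c + 2κ(rest j' + lap1 (τ j') i))`. [folklore] -/
def genProd (L : ℕ) (κ c : ℝ) (rest τ : (Fin 2 → Fin L) → ℝ) : ℝ :=
  ∏ j' : Fin 2 → Fin L, ∏ i : Fin L, (c + 2 * κ * (rest j' + lap1 L (τ j') i))

/-! ## §2 Elementary properties -/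

/-- `0 ≤ 2 − 2cos(a + 2πi/L)`. [folklore] -/
theorem lap1_nonneg (L : ℕ) (a : ℝ) (i : Fin L) : 0 ≤ lap1 L a i := by
  unfold lap1; linarith [Real.cos_le_one (a + 2 * Real.pi * (i : ℕ) / L)]

/-- `0 ≤ lap3`. [folklore] -/
theorem lap3_nonneg (L : ℕ) (α : Fin 3 → ℝ) (j : Fin 3 → Fin L) : 0 ≤ lap3 L α j :=
  sum_nonneg fun k _ => lap1_nonneg L (α k) (j k)

/-- `0 ≤ lap2`. [folklore] -/
theorem lap2_nonneg (L : ℕ) (α' : Fin 2 → ℝ) (j' : Fin 2 → Fin L) : 0 ≤ lap2 L α' j' :=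
  sum_nonneg fun k _ => lap1_nonneg L (α' k) (j' k)

/-- `lap1` is `2π`-periodic in the twist. [folklore] -/
theorem lap1_add_two_pi (L : ℕ) (a : ℝ) (i : Fin L) : lap1 L (a + 2 * Real.pi) i = lap1 L a i := by
  unfold lap1
  rw [show a + 2 * Real.pi + 2 * Real.pi * (i : ℕ) / L = a + 2 * Real.pi * (i : ℕ) / L + 2 * Real.pi by ring, Real.cos_add_two_pi]

/-- The zero-twist symbol at momentum `0` vanishes: `lap1 L 0 0 = 0` (`L ≥ 1`). [folklore] -/
theorem lap1_zero_zero (L : ℕ) [NeZero L] : lap1 L 0 (0 : Fin L) = 0 := by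
  unfold lap1
  rw [Fin.val_zero]; norm_num

/-- `modeZPE y ≥ 0` for `y ≥ 0`. [folklore] -/
theorem modeZPE_nonneg {y : ℝ} (hy : 0 ≤ y) : 0 ≤ modeZPE y := by
  unfold modeZPE; exact div_nonneg (Real.arcosh_nonneg (by linarith)) (by norm_num)

/-- `modeZPE y > 0` for `y > 0`. [folklore] -/
theorem modeZPE_pos {y : ℝ} (hy : 0 < y) : 0 < modeZPE y := by
  unfold modeZPE; exact div_pos (Real.arcosh_pos (by linarith)) (by norm_num)

/-- `modeZPE 0 = 0`. [folklore] -/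
theorem modeZPE_zero : modeZPE 0 = 0 := by simp [modeZPE, Real.arcosh_zero]

/-- `modeZPE` is monotone on `[0, ∞)`. [folklore] -/
theorem modeZPE_le_modeZPE {x y : ℝ} (hx : 0 ≤ x) (hxy : x ≤ y) : modeZPE x ≤ modeZPE y := by
  unfold modeZPE
  exact div_le_div_of_nonneg_right ((Real.arcosh_le_arcosh (by linarith) (by linarith)).mpr (by linarith)) (by norm_num)

/-- `arcosh` is continuous at every `x ≥ 1`. [folklore] -/
theorem continuousAt_arcosh {x : ℝ} (hx : 1 ≤ x) : ContinuousAt Real.arcosh x := by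
  have h : Real.arcosh = fun x : ℝ => Real.log (x + Real.sqrt (x ^ 2 - 1)) := rfl
  rw [h]
  refine ContinuousAt.log (continuousAt_id.add (((continuousAt_id.pow 2).sub continuousAt_const).sqrt)) ?_
  show x + Real.sqrt (x ^ 2 - 1) ≠ 0
  have := Real.sqrt_nonneg (x ^ 2 - 1)
  exact ne_of_gt (by linarith)

/-- Continuity of the massive mode energy in the mass at `m = 0`. [folklore] -/
theorem continuousAt_modeZPE_add {c : ℝ} (hc : 0 ≤ c) : ContinuousAt (fun m : ℝ => modeZPE (m + c)) 0 := by
  unfold modeZPE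
  refine ContinuousAt.div_const ?_ _
  have h1 : ContinuousAt (fun m : ℝ => 1 + (m + c)) 0 := continuousAt_const.add (continuousAt_id.add continuousAt_const)
  exact ContinuousAt.comp (g := Real.arcosh) (f := fun m : ℝ => 1 + (m + c)) (x := 0)
    (continuousAt_arcosh (x := 1 + (0 + c)) (by linarith)) h1

/-! ## §3 The determinant level: zeroing twists lowers the generalised determinant -/

/-- Scaled twisted massive 1D determinant: for `C ≥ 0`, `s > 0`,
`Π_i (C + s·lap1 L 0 i) ≤ Π_i (C + s·lap1 L a i)`. [folklore] -/
theorem prod_mass_add_smul_lap1_ge (L : ℕ) [NeZero L] {C s : ℝ} (hC : 0 ≤ C) (hs : 0 < s) (a : ℝ) :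
    ∏ i : Fin L, (C + s * lap1 L 0 i) ≤ ∏ i : Fin L, (C + s * lap1 L a i) := by
  have hL : 0 < L := Nat.pos_of_ne_zero (NeZero.ne L)
  have hfac : ∀ (b : ℝ) (i : Fin L), C + s * lap1 L b i = s * (C / s + lap1 L b i) := fun b i => by
    field_simp
  simp_rw [hfac, prod_mul_distrib, prod_const]
  refine mul_le_mul_of_nonneg_left ?_ (by positivity)
  have h := prod_univ_mass_add_twoSubTwoCos_ge hL (c := C / s) (div_nonneg hC hs.le) a
  unfold lap1
  simp only [zero_add]
  exact h

/-- ★ **Determinant monotonicity**: for `c ≥ 0`, `κ > 0`, `rest ≥ 0` and twists `τ'`, `τ` with `τ' j' ∈ {τ j', 0}` for every transverse momentum,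
`genProd L κ c rest τ' ≤ genProd L κ c rest τ`. [folklore] -/
theorem genProd_le_of_zeroing (L : ℕ) [NeZero L] {κ c : ℝ} (hκ : 0 < κ) (hc : 0 ≤ c) {rest τ τ' : (Fin 2 → Fin L) → ℝ}
    (hrest : ∀ j', 0 ≤ rest j') (hτ : ∀ j', τ' j' = τ j' ∨ τ' j' = 0) :
    genProd L κ c rest τ' ≤ genProd L κ c rest τ := by
  unfold genProd
  refine prod_le_prod (fun j' _ => prod_nonneg fun i _ => ?_) fun j' _ => ?_
  · have := hrest j'; have := lap1_nonneg L (τ' j') i; positivity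
  · have hre : ∀ (b : ℝ) (i : Fin L), c + 2 * κ * (rest j' + lap1 L b i) = (c + 2 * κ * rest j') + (2 * κ) * lap1 L b i :=
      fun b i => by ring
    simp_rw [hre]
    rcases hτ j' with h | h
    · rw [h]
    · rw [h]
      exact prod_mass_add_smul_lap1_ge L (by have := hrest j'; positivity) (by positivity) (τ j')

/-- `genProd` is non-negative. [folklore] -/
theorem genProd_nonneg (L : ℕ) {κ c : ℝ} (hκ : 0 ≤ κ) (hc : 0 ≤ c) {rest : (Fin 2 → Fin L) → ℝ} (hrest : ∀ j', 0 ≤ rest j')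
    (τ : (Fin 2 → Fin L) → ℝ) : 0 ≤ genProd L κ c rest τ :=
  prod_nonneg fun j' _ => prod_nonneg fun i _ => by
    have := hrest j'; have := lap1_nonneg L (τ j') i; positivity

/-! ## §4 From determinants to zero-point energies (massive), then `m → 0⁺` -/

/-- The temporal product of one mode: `2cosh(T·2·modeZPE y) − 2 = Π_{l<T} (2y + (2 − 2cos(2πl/T)))`, `y ≥ 0`. [folklore] -/
theorem two_cosh_mul_modeZPE_eq {T : ℕ} (hT : 0 < T) {y : ℝ} (hy : 0 ≤ y) :
    2 * Real.cosh (T * (2 * modeZPE y)) - 2 = ∏ l ∈ range T, (2 * y + (2 - 2 * Real.cos (2 * Real.pi * l / T))) := by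
  unfold modeZPE
  rw [mul_div_cancel₀ _ (two_ne_zero), prod_range_twoMul_add_eq hT hy]

/-- ★ **Massive monotonicity of the generalised sums**: `m > 0`, `κ > 0`, `rest ≥ 0`, `τ' ∈ {τ, 0}` pointwise ⇒
`genSum L κ m rest τ' ≤ genSum L κ m rest τ`. [folklore] -/
theorem genSum_le_of_zeroing_pos (L : ℕ) [NeZero L] {κ m : ℝ} (hκ : 0 < κ) (hm : 0 < m) {rest τ τ' : (Fin 2 → Fin L) → ℝ}
    (hrest : ∀ j', 0 ≤ rest j') (hτ : ∀ j', τ' j' = τ j' ∨ τ' j' = 0) :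
    genSum L κ m rest τ' ≤ genSum L κ m rest τ := by
  -- energies on the product index type
  set y : ((Fin 2 → Fin L) → ℝ) → (Fin 2 → Fin L) × Fin L → ℝ := fun σ p => m + κ * (rest p.1 + lap1 L (σ p.1) p.2) with hydef
  have hy0 : ∀ σ p, 0 < y σ p := fun σ p => by
    have := hrest p.1; have := lap1_nonneg L (σ p.1) p.2; rw [hydef]; dsimp only; positivity
  have key := sum_le_sum_of_prod_cosh_le (u := fun p => 2 * modeZPE (y τ p)) (ut := fun p => 2 * modeZPE (y τ' p))
    (fun p => by have := modeZPE_nonneg (hy0 τ p).le; positivity) (fun p => by have := modeZPE_pos (hy0 τ' p); positivity) ?_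
  · -- unpack the conclusion
    have hS : ∀ σ, genSum L κ m rest σ = (∑ p : (Fin 2 → Fin L) × Fin L, 2 * modeZPE (y σ p)) / 2 := fun σ => by
      rw [genSum, ← mul_sum, mul_div_cancel_left₀ _ (two_ne_zero), Fintype.sum_prod_type]
    rw [hS τ', hS τ]
    exact div_le_div_of_nonneg_right key (by norm_num)
  · intro T hT
    have hcl : ∀ l : ℕ, 0 ≤ 2 * m + (2 - 2 * Real.cos (2 * Real.pi * l / T)) := fun l => by
      have := Real.cos_le_one (2 * Real.pi * l / T); linarith
    have hrew : ∀ σ, ∏ p : (Fin 2 → Fin L) × Fin L, (2 * Real.cosh (T * (2 * modeZPE (y σ p))) - 2) =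
        ∏ l ∈ range T, genProd L κ (2 * m + (2 - 2 * Real.cos (2 * Real.pi * l / T))) rest σ := fun σ => by
      rw [prod_congr rfl fun p _ => two_cosh_mul_modeZPE_eq hT (hy0 σ p).le, Finset.prod_comm]
      refine prod_congr rfl fun l _ => ?_
      rw [genProd, Fintype.prod_prod_type]
      refine Fintype.prod_congr _ _ fun j' => Fintype.prod_congr _ _ fun i => ?_
      rw [hydef]; ring
    rw [hrew τ', hrew τ]
    exact prod_le_prod (fun l _ => genProd_nonneg L hκ.le (hcl l) hrest τ') fun l _ => genProd_le_of_zeroing L hκ (hcl l) hrest hτ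

/-- Continuity of the generalised sum in the mass at `m = 0`. [folklore] -/
theorem continuousAt_genSum (L : ℕ) {κ : ℝ} (hκ : 0 ≤ κ) {rest : (Fin 2 → Fin L) → ℝ} (hrest : ∀ j', 0 ≤ rest j')
    (τ : (Fin 2 → Fin L) → ℝ) : ContinuousAt (fun m : ℝ => genSum L κ m rest τ) 0 := by
  unfold genSum ContinuousAt
  refine tendsto_finsetSum _ fun j' _ => tendsto_finsetSum _ fun i _ => ?_
  exact (continuousAt_modeZPE_add (by have := hrest j'; have := lap1_nonneg L (τ j') i; positivity)).tendsto

/-- ★ **Massless monotonicity of the generalised sums** (`m = 0`, by continuity). [folklore] -/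
theorem genSum_le_of_zeroing (L : ℕ) [NeZero L] {κ : ℝ} (hκ : 0 < κ) {rest τ τ' : (Fin 2 → Fin L) → ℝ}
    (hrest : ∀ j', 0 ≤ rest j') (hτ : ∀ j', τ' j' = τ j' ∨ τ' j' = 0) :
    genSum L κ 0 rest τ' ≤ genSum L κ 0 rest τ := by
  have h1 : Tendsto (fun m : ℝ => genSum L κ m rest τ') (𝓝[>] 0) (𝓝 (genSum L κ 0 rest τ')) :=
    tendsto_nhdsWithin_of_tendsto_nhds (continuousAt_genSum L hκ.le hrest τ').tendsto
  have h2 : Tendsto (fun m : ℝ => genSum L κ m rest τ) (𝓝[>] 0) (𝓝 (genSum L κ 0 rest τ)) :=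
    tendsto_nhdsWithin_of_tendsto_nhds (continuousAt_genSum L hκ.le hrest τ).tendsto
  exact le_of_tendsto_of_tendsto h1 h2 (eventually_nhdsWithin_of_forall fun m hm => genSum_le_of_zeroing_pos L hκ hm hrest hτ)

/-! ## §5 Reindexing: `toronZPE` of `Fin.cons a α'` as a generalised sum; permutations; periodicity -/

/-- `lap3 (cons a α') (cons i j') = lap1 a i + lap2 α' j'`. [folklore] -/
theorem lap3_cons (L : ℕ) (a : ℝ) (α' : Fin 2 → ℝ) (i : Fin L) (j' : Fin 2 → Fin L) :
    lap3 L (Fin.cons a α') (Fin.cons i j') = lap1 L a i + lap2 L α' j' := by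
  simp [lap3, lap2, Fin.sum_univ_succ]

/-- ★ `toronZPE L κ m (Fin.cons a α') = genSum L κ m (lap2 L α') (fun _ => a)`. [folklore] -/
theorem toronZPE_cons_eq_genSum (L : ℕ) (κ m a : ℝ) (α' : Fin 2 → ℝ) :
    toronZPE L κ m (Fin.cons a α') = genSum L κ m (lap2 L α') (fun _ => a) := by
  unfold toronZPE genSum
  rw [← (Fin.consEquiv fun _ : Fin 3 => Fin L).sum_comp, Fintype.sum_prod_type, sum_comm]
  refine Fintype.sum_congr _ _ fun j' => Fintype.sum_congr _ _ fun i => ?_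
  have h : (Fin.consEquiv fun _ : Fin 3 => Fin L) (i, j') = Fin.cons i j' := rfl
  rw [h, lap3_cons, add_comm (lap1 L a i)]

/-- `toronZPE` is invariant under permuting the three directions. [folklore] -/
theorem toronZPE_comp_perm (L : ℕ) (κ m : ℝ) (α : Fin 3 → ℝ) (σ : Equiv.Perm (Fin 3)) :
    toronZPE L κ m (α ∘ σ) = toronZPE L κ m α := by
  unfold toronZPE
  have h : ∀ j : Fin 3 → Fin L, lap3 L (α ∘ σ) j = lap3 L α ((σ.arrowCongr (Equiv.refl (Fin L))) j) := fun j => by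
    unfold lap3
    simp only [Function.comp_apply, Equiv.arrowCongr_apply, Equiv.coe_refl, id_eq]
    rw [← Equiv.sum_comp σ (fun k' => lap1 L (α k') (j (σ.symm k')))]
    simp only [Equiv.symm_apply_apply]
  simp_rw [h]
  exact Equiv.sum_comp (σ.arrowCongr (Equiv.refl (Fin L))) (fun j => modeZPE (m + κ * lap3 L α j))

/-- `lap3` written out over the three directions. [folklore] -/
theorem lap3_eq (L : ℕ) (α : Fin 3 → ℝ) (j : Fin 3 → Fin L) :
    lap3 L α j = lap1 L (α 0) (j 0) + lap1 L (α 1) (j 1) + lap1 L (α 2) (j 2) := by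
  unfold lap3; rw [Fin.sum_univ_three]

/-- `lap1` is `2π/L`-periodic in the twist up to the momentum shift `i ↦ i + 1`: `lap1 L (a + 2π/L) i = lap1 L a (i + 1)`. [folklore] -/
theorem lap1_add_period (L : ℕ) [NeZero L] (a : ℝ) (i : Fin L) : lap1 L (a + 2 * Real.pi / L) i = lap1 L a (i + 1) := by
  unfold lap1
  have hL : (L : ℝ) ≠ 0 := by exact_mod_cast NeZero.ne L
  rcases Nat.lt_or_ge ((i : ℕ) + 1) L with hlt | hge
  · have hv : ((i + 1 : Fin L) : ℕ) = (i : ℕ) + 1 := Fin.val_add_one_of_lt' hlt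
    rw [hv]; push_cast
    congr 2; field_simp; ring
  · have hL' : (i : ℕ) + 1 = L := by have := i.isLt; omega
    have hv : ((i + 1 : Fin L) : ℕ) = 0 := by
      rw [Fin.val_add, Fin.val_one', Nat.add_mod_mod, hL', Nat.mod_self]
    rw [hv]
    have hj : ((i : ℕ) : ℝ) = L - 1 := by
      have : (((i : ℕ) + 1 : ℕ) : ℝ) = L := by exact_mod_cast hL'
      push_cast at this; linarith
    rw [hj]; push_cast
    rw [show a + 2 * Real.pi / L + 2 * Real.pi * ((L : ℝ) - 1) / L = (a + 2 * Real.pi * (0 : ℝ) / L) + 2 * Real.pi by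
      field_simp; ring, Real.cos_add_two_pi]

/-- `toronZPE` is `2π`-periodic in each twist. [folklore] -/
theorem toronZPE_add_two_pi (L : ℕ) (κ m : ℝ) (α : Fin 3 → ℝ) (k : Fin 3) :
    toronZPE L κ m (Function.update α k (α k + 2 * Real.pi)) = toronZPE L κ m α := by
  unfold toronZPE
  refine Fintype.sum_congr _ _ fun j => ?_
  rw [lap3_eq, lap3_eq]
  fin_cases k <;> simp [lap1_add_two_pi]

/-- `toronZPE` is `2π/L`-periodic in each twist (shift the momentum index of that direction by one). [folklore] -/
theorem toronZPE_add_period (L : ℕ) [NeZero L] (κ m : ℝ) (α : Fin 3 → ℝ) (k : Fin 3) :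
    toronZPE L κ m (Function.update α k (α k + 2 * Real.pi / L)) = toronZPE L κ m α := by
  unfold toronZPE
  -- reindex `j ↦ update j k (j k + 1)`
  let e : (Fin 3 → Fin L) ≃ (Fin 3 → Fin L) :=
    { toFun := fun j => Function.update j k (j k + 1)
      invFun := fun j => Function.update j k (j k - 1)
      left_inv := fun j => by
        funext k'; by_cases h : k' = k
        · subst h; simp
        · simp [Function.update_of_ne h]
      right_inv := fun j => by
        funext k'; by_cases h : k' = k
        · subst h; simp
        · simp [Function.update_of_ne h] }
  refine (Fintype.sum_congr _ _ fun j => ?_).trans (Equiv.sum_comp e (fun j => modeZPE (m + κ * lap3 L α j)))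
  have he : e j = Function.update j k (j k + 1) := rfl
  rw [he, lap3_eq, lap3_eq]
  fin_cases k <;> simp [lap1_add_period]

/-! ## §6 THEOREM A: the torons minimise the zero-point energy -/

/-- `Function.update α 0 0 = Fin.cons 0 (Fin.tail α)` and `α = Fin.cons (α 0) (Fin.tail α)`. [folklore] -/
theorem update_zero_eq_cons (α : Fin 3 → ℝ) : Function.update α 0 0 = Fin.cons 0 (Fin.tail α) := by
  funext k; refine Fin.cases ?_ (fun k' => ?_) k
  · simp
  · rw [Function.update_of_ne (Fin.succ_ne_zero k'), Fin.cons_succ, Fin.tail]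

/-- ★ Zeroing the first twist never raises the zero-point energy. [folklore] -/
theorem toronZPE_update_fst_zero_le (L : ℕ) [NeZero L] {κ : ℝ} (hκ : 0 < κ) (α : Fin 3 → ℝ) :
    toronZPE L κ 0 (Function.update α 0 0) ≤ toronZPE L κ 0 α := by
  rw [update_zero_eq_cons, toronZPE_cons_eq_genSum]
  conv_rhs => rw [← Fin.cons_self_tail α, toronZPE_cons_eq_genSum]
  exact genSum_le_of_zeroing L hκ (lap2_nonneg L _) fun _ => Or.inr rfl

/-- ★ **Zeroing any one twist never raises the zero-point energy.** [folklore] -/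
theorem toronZPE_update_zero_le (L : ℕ) [NeZero L] {κ : ℝ} (hκ : 0 < κ) (α : Fin 3 → ℝ) (k : Fin 3) :
    toronZPE L κ 0 (Function.update α k 0) ≤ toronZPE L κ 0 α := by
  set σ : Equiv.Perm (Fin 3) := Equiv.swap 0 k
  have h1 : toronZPE L κ 0 α = toronZPE L κ 0 (α ∘ σ) := (toronZPE_comp_perm L κ 0 α σ).symm
  have h2 : toronZPE L κ 0 (Function.update α k 0) = toronZPE L κ 0 (Function.update (α ∘ σ) 0 0) := by
    rw [← toronZPE_comp_perm L κ 0 (Function.update α k 0) σ, Function.update_comp_equiv]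
    simp [σ]
  rw [h1, h2]
  exact toronZPE_update_fst_zero_le L hκ _

/-- ★★ **THEOREM A — TORON MINIMALITY**: `toronZPE L κ 0 0 ≤ toronZPE L κ 0 α` for every twist `α` (`κ > 0`, `L ≥ 1`). [cite: Luscher1983, §3] -/
theorem toronZPE_zero_le (L : ℕ) [NeZero L] {κ : ℝ} (hκ : 0 < κ) (α : Fin 3 → ℝ) :
    toronZPE L κ 0 (fun _ => 0) ≤ toronZPE L κ 0 α := by
  have h : (fun _ : Fin 3 => (0 : ℝ)) = Function.update (Function.update (Function.update α 0 0) 1 0) 2 0 := by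
    funext k; fin_cases k <;> simp
  rw [h]
  exact ((toronZPE_update_zero_le L hκ _ 2).trans (toronZPE_update_zero_le L hκ _ 1)).trans (toronZPE_update_zero_le L hκ α 0)

/-! ## §7 THEOREM B (reduction): the gain dominates the one-dimensional massless gain of each direction -/

/-- The hybrid step at direction `0`: `toronZPE L κ 0 0 + gain1 L κ a ≤ toronZPE L κ 0 (Fin.cons a 0)`. [folklore] -/
theorem toronZPE_zero_add_gain1_le_cons (L : ℕ) [NeZero L] {κ : ℝ} (hκ : 0 < κ) (a : ℝ) :
    toronZPE L κ 0 (fun _ => 0) + gain1 L κ a ≤ toronZPE L κ 0 (Fin.cons a (fun _ => 0)) := by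
  -- hybrid twist: `a` only at transverse momentum `0`
  set τ' : (Fin 2 → Fin L) → ℝ := fun j' => if j' = 0 then a else 0 with hτ'
  have hmono : genSum L κ 0 (lap2 L fun _ => 0) τ' ≤ genSum L κ 0 (lap2 L fun _ => 0) (fun _ => a) :=
    genSum_le_of_zeroing L hκ (lap2_nonneg L _) fun j' => by
      by_cases h : j' = 0
      · exact Or.inl (by simp [τ', h])
      · exact Or.inr (by simp [τ', h])
  have h0 : toronZPE L κ 0 (fun _ => 0) = genSum L κ 0 (lap2 L fun _ => 0) (fun _ => 0) := by
    have : (fun _ : Fin 3 => (0 : ℝ)) = Fin.cons 0 (fun _ => 0) := by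
      funext k; refine Fin.cases ?_ (fun k' => ?_) k <;> simp
    rw [this, toronZPE_cons_eq_genSum]
  have hrest0 : lap2 L (fun _ => (0 : ℝ)) (0 : Fin 2 → Fin L) = 0 := by
    simp [lap2, lap1_zero_zero]
  have hdiff : genSum L κ 0 (lap2 L fun _ => 0) τ' - genSum L κ 0 (lap2 L fun _ => 0) (fun _ => 0) = gain1 L κ a := by
    unfold genSum
    rw [← sum_sub_distrib, Finset.sum_eq_single (0 : Fin 2 → Fin L)]
    · rw [hrest0, gain1, ← sum_sub_distrib]
      refine Fintype.sum_congr _ _ fun i => ?_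
      simp [τ']
    · intro j' _ hj'
      simp [τ', hj']
    · intro h; exact absurd (mem_univ _) h
  rw [toronZPE_cons_eq_genSum, h0]
  linarith

/-- `Function.update (Function.update α 1 0) 2 0 = Fin.cons (α 0) 0`. [folklore] -/
theorem update_update_eq_cons (α : Fin 3 → ℝ) :
    Function.update (Function.update α 1 0) 2 0 = Fin.cons (α 0) (fun _ => 0) := by
  funext k; fin_cases k
  · simp
  · simp
  · show Function.update (Function.update α 1 0) 2 0 2 = (Fin.cons (α 0) (fun _ => (0 : ℝ)) : Fin 3 → ℝ) 2
    rw [Function.update_self]; rfl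

/-- ★★ **THEOREM B (reduction to one dimension)**: for every direction `k`,
`toronZPE L κ 0 0 + gain1 L κ (α k) ≤ toronZPE L κ 0 α` — the zero-point gain of a flat background over the torons dominates the one-dimensional
massless gain of each of its twists. [cite: Luscher1983, §3] -/
theorem toronZPE_zero_add_gain1_le (L : ℕ) [NeZero L] {κ : ℝ} (hκ : 0 < κ) (α : Fin 3 → ℝ) (k : Fin 3) :
    toronZPE L κ 0 (fun _ => 0) + gain1 L κ (α k) ≤ toronZPE L κ 0 α := by
  -- bring direction `k` to the front
  set σ : Equiv.Perm (Fin 3) := Equiv.swap 0 k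
  set β : Fin 3 → ℝ := α ∘ σ with hβ
  have hβ0 : β 0 = α k := by simp [hβ, σ]
  rw [← toronZPE_comp_perm L κ 0 α σ, ← hβ0]
  calc toronZPE L κ 0 (fun _ => 0) + gain1 L κ (β 0)
      ≤ toronZPE L κ 0 (Fin.cons (β 0) (fun _ => 0)) := toronZPE_zero_add_gain1_le_cons L hκ (β 0)
    _ = toronZPE L κ 0 (Function.update (Function.update β 1 0) 2 0) := by rw [update_update_eq_cons]
    _ ≤ toronZPE L κ 0 (Function.update β 1 0) := toronZPE_update_zero_le L hκ _ 2
    _ ≤ toronZPE L κ 0 β := toronZPE_update_zero_le L hκ β 1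

end Summit.QuantumFields.YangMills.Theorems.FemtoTransferGap.TwoLattice.Toron

end
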